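import Summits.RiemannHypothesis.RiemannHypothesis.Theorems.WeilBochnerMeasureRung
import Mathlib.MeasureTheory.Measure.CharacteristicFunction.Basic
import HarnessLib

/-!
# RiemannHypothesis — a measure representing Weil's form on ALL windows is unique (and, under RH, is the zeros)

Helper file (`--supports stmt-RiemannHypothesis-0098`), RH-free, standard axioms.  Seat rh-explicit
weil-3 (structure).

A single window `[-b, b]` does not determine its representing measure (only its Fourier transform on
`(-2b, 2b)`, `integral_weilMellin_eq_integral_weilMellin`).  ALL windows together do:

* **`eq_of_forall_represents`**: if `μ₁` and `μ₂` both represent Weil's form on every test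
  (`‖ĝ(½+it)‖² ∈ L¹` and `W(g ⋆ g̃) = ∫ ‖ĝ(½+it)‖² dμᵢ` for every smooth compactly supported `g`), then
  `μ₁ = μ₂`.  Proof: with the zero-free kernel `κ` (`κ̂ = G > 0`) and its translates, the kernels
  `κ + ½(κ(·−x) + κ(·+x))` and `κ + (κ(·−x) − κ(·+x))/2i` have the nonnegative transforms
  `G(1 + cos xt)`, `G(1 + sin xt)`, so `weilFunctional_kernel_eq_integral` computes
  `∫ G e^{ixt} dμᵢ` from `W` alone; hence the finite measures `G·μᵢ` have the same characteristic
  function and coincide (Lévy, Mathlib `Measure.ext_of_charFun`), and `G > 0` gives `μ₁ = μ₂`.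
* **`riemannHypothesis_iff_existsUnique_spectral_measure`**: `RH ↔ ∃! μ, ∀ tests k,
  k̂(½+i·) ∈ L¹(μ) ∧ ∫ k̂(½+it) dμ = W(k)`.
* `eq_zetaZeroHeightMeasure_of_riemannHypothesis`: under RH every such `μ` IS the zero-counting
  measure `Σ_ρ m_ρ δ_{Im ρ}` (`WeilBochner.zetaZeroHeightMeasure`).
-/

noncomputable section

set_option linter.dupNamespace false  -- the mandated namespace repeats `RiemannHypothesis`

open Complex Filter Set MeasureTheory
open scoped Real Topology ComplexConjugate ENNReal NNReal
open Literature.NumberTheory.LFunctions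

namespace Summit.RiemannHypothesis.RiemannHypothesis.Theorems.WeilBochnerMeasure

/-! ## Translates of a kernel -/

/-- Translation is modulation on the critical line: `(k(· − x))^(½+it) = e^{itx} k̂(½+it)`. -/
theorem weilMellin_comp_sub_half (k : ℝ → ℂ) (x t : ℝ) :
    weilMellin (fun y ↦ k (y - x)) (1 / 2 + t * I) = cexp (t * x * I) * weilMellin k (1 / 2 + t * I) := by
  unfold weilMellin
  have h : (fun y : ℝ ↦ k (y - x) * cexp ((1 / 2 + t * I - 1 / 2) * (y : ℂ))) =
      fun y ↦ (fun z : ℝ ↦ cexp (t * x * I) * (k z * cexp ((1 / 2 + t * I - 1 / 2) * (z : ℂ))))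
        (y - x) := by
    funext y
    simp only
    rw [← mul_assoc, mul_comm (cexp _) (k _), mul_assoc, ← Complex.exp_add]
    congr 2
    push_cast
    ring
  rw [h, integral_sub_right_eq_self
    (fun z : ℝ ↦ cexp (t * x * I) * (k z * cexp ((1 / 2 + t * I - 1 / 2) * (z : ℂ)))) x,
    MeasureTheory.integral_const_mul]

/-! ## Uniqueness -/

/-- **A measure representing Weil's form on every test is unique.**  If `μ₁`, `μ₂` both satisfy
`‖ĝ(½+it)‖² ∈ L¹(μᵢ)` and `W(g ⋆ g̃) = ∫ ‖ĝ(½+it)‖² dμᵢ` for every smooth compactly supported `g`,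
then `μ₁ = μ₂`. -/
theorem eq_of_forall_represents {μ₁ μ₂ : Measure ℝ}
    (h₁ : ∀ g : ℝ → ℂ, IsWeilTest g →
      Integrable (fun t : ℝ ↦ ‖weilMellin g (1 / 2 + t * I)‖ ^ 2) μ₁ ∧
        weilQuadratic g = ((∫ t, ‖weilMellin g (1 / 2 + t * I)‖ ^ 2 ∂μ₁ : ℝ) : ℂ))
    (h₂ : ∀ g : ℝ → ℂ, IsWeilTest g →
      Integrable (fun t : ℝ ↦ ‖weilMellin g (1 / 2 + t * I)‖ ^ 2) μ₂ ∧
        weilQuadratic g = ((∫ t, ‖weilMellin g (1 / 2 + t * I)‖ ^ 2 ∂μ₂ : ℝ) : ℂ)) :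
    μ₁ = μ₂ := by
  -- the zero-free kernel and its transform `G > 0`
  obtain ⟨κ, hκc, hκs, hκ⟩ := exists_zeroFree_kernel one_pos le_rfl
  set G : ℝ → ℝ := fun t ↦ (weilMellin κ (1 / 2 + t * I)).re with hGdef
  have hκG : ∀ t : ℝ, weilMellin κ (1 / 2 + t * I) = (G t : ℂ) := fun t ↦
    Complex.ext (by simp [hGdef]) (by rw [Complex.ofReal_im]; exact (hκ t).1)
  have hκcs : HasCompactSupport κ := isCompact_Icc.of_isClosed_subset (isClosed_tsupport _) hκs
  have hGc : Continuous G := by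
    have h1 : Continuous fun t : ℝ ↦ (1 / 2 : ℂ) + t * I := by fun_prop
    exact Complex.continuous_re.comp ((continuous_weilMellin hκc hκcs).comp h1)
  have hGpos : ∀ t, 0 < G t := fun t ↦ lt_of_lt_of_le (by positivity) (hκ t).2.1
  have hGle : ∀ t, G t ≤ 36 / (1 + t ^ 2) := fun t ↦ by
    have h := (hκ t).2.2
    rw [one_mul] at h
    exact ((Complex.abs_re_le_norm _).trans h) |> (le_abs_self _).trans
  have hκ0 : ∀ y : ℝ, 2 < |y| → κ y = 0 := fun y hy ↦
    image_eq_zero_of_notMem_tsupport fun h ↦ by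
      have h' := hκs h
      simp only [mul_one, mem_Icc] at h'
      have := abs_le.2 ⟨h'.1, h'.2⟩
      linarith
  -- the three characteristic integrals `∫ G dμ`, `∫ G cos(xt) dμ`, `∫ G sin(xt) dμ` are determined by `W`
  have key : ∀ {μ : Measure ℝ},
      (∀ g : ℝ → ℂ, IsWeilTest g →
        Integrable (fun t : ℝ ↦ ‖weilMellin g (1 / 2 + t * I)‖ ^ 2) μ ∧
          weilQuadratic g = ((∫ t, ‖weilMellin g (1 / 2 + t * I)‖ ^ 2 ∂μ : ℝ) : ℂ)) →
      Integrable G μ ∧ ∀ x : ℝ,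
        Integrable (fun t ↦ G t * Real.cos (x * t)) μ ∧ Integrable (fun t ↦ G t * Real.sin (x * t)) μ ∧
        (((∫ t, G t * (1 + Real.cos (x * t)) ∂μ : ℝ) : ℂ) =
          weilFunctional (fun y ↦ κ y + (κ (y - x) + κ (y + x)) / 2)) ∧
        (((∫ t, G t * (1 + Real.sin (x * t)) ∂μ : ℝ) : ℂ) =
          weilFunctional (fun y ↦ κ y + (κ (y - x) - κ (y + x)) / (2 * I))) := by
    intro μ hμ
    -- `μ` represents every window
    have hμb : ∀ b : ℝ, ∀ g : ℝ → ℂ, IsWeilTest g → tsupport g ⊆ Icc (-b) b →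
        Integrable (fun t : ℝ ↦ ‖weilMellin g (1 / 2 + t * I)‖ ^ 2) μ ∧
          weilQuadratic g = ((∫ t, ‖weilMellin g (1 / 2 + t * I)‖ ^ 2 ∂μ : ℝ) : ℂ) :=
      fun b g hg _ ↦ hμ g hg
    -- `κ` itself
    obtain ⟨hIG, -⟩ := weilFunctional_kernel_eq_integral (b := 2) (by norm_num) (hμb 2) hκc
      (a := 2 * 1) (by norm_num) hκs (M := 36) (fun u ↦ by have h := (hκ u).2.2; rwa [one_mul] at h)
      (fun u ↦ ⟨(hκ u).1, le_of_lt (hGpos u)⟩)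
    simp only [hκG, Complex.ofReal_re] at hIG
    refine ⟨hIG, fun x ↦ ?_⟩
    -- the two kernels
    set kc : ℝ → ℂ := fun y ↦ κ y + (κ (y - x) + κ (y + x)) / 2 with hkc
    set ks : ℝ → ℂ := fun y ↦ κ y + (κ (y - x) - κ (y + x)) / (2 * I) with hks
    have hm : Continuous fun y : ℝ ↦ κ (y - x) := hκc.comp (continuous_id.sub continuous_const)
    have hp : Continuous fun y : ℝ ↦ κ (y + x) := hκc.comp (continuous_id.add continuous_const)
    have hkcc : Continuous kc := hκc.add ((hm.add hp).div_const _)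
    have hksc : Continuous ks := hκc.add ((hm.sub hp).div_const _)
    -- supports inside `[-(2+|x|), 2+|x|]`
    have hzero : ∀ y : ℝ, 2 + |x| < |y| → κ y = 0 ∧ κ (y - x) = 0 ∧ κ (y + x) = 0 := by
      intro y hy
      refine ⟨hκ0 y (by linarith [abs_nonneg x]), hκ0 _ ?_, hκ0 _ ?_⟩
      · have := abs_sub_abs_le_abs_sub y x; linarith
      · have := abs_sub_abs_le_abs_sub y (-x)
        rw [abs_neg, sub_neg_eq_add] at this; linarith
    have hsupp : ∀ f : ℝ → ℂ, (∀ y, 2 + |x| < |y| → f y = 0) → tsupport f ⊆ Icc (-(2 + |x|)) (2 + |x|) := by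
      intro f hf
      refine closure_minimal (fun y hy ↦ ?_) isClosed_Icc
      rw [Function.mem_support] at hy
      by_contra hyI
      rw [mem_Icc, not_and_or, not_le, not_le] at hyI
      refine hy (hf y ?_)
      rcases hyI with h | h
      · rw [abs_of_neg (show y < 0 by linarith [abs_nonneg x])]; linarith
      · rw [abs_of_pos (show 0 < y by linarith [abs_nonneg x])]; linarith
    have hkcs : tsupport kc ⊆ Icc (-(2 + |x|)) (2 + |x|) := hsupp kc fun y hy ↦ by
      obtain ⟨h0, hm0, hp0⟩ := hzero y hy; simp [hkc, h0, hm0, hp0]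
    have hkss : tsupport ks ⊆ Icc (-(2 + |x|)) (2 + |x|) := hsupp ks fun y hy ↦ by
      obtain ⟨h0, hm0, hp0⟩ := hzero y hy; simp [hks, h0, hm0, hp0]
    have hmcs : HasCompactSupport fun y : ℝ ↦ κ (y - x) :=
      hκcs.comp_homeomorph (Homeomorph.subRight x)
    have hpcs : HasCompactSupport fun y : ℝ ↦ κ (y + x) :=
      hκcs.comp_homeomorph (Homeomorph.addRight x)
    -- transforms: `G (1 + cos xt)` and `G (1 + sin xt)`
    have hmline : ∀ t : ℝ, weilMellin (fun y ↦ κ (y - x)) (1 / 2 + t * I) = cexp (t * x * I) * G t :=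
      fun t ↦ by rw [weilMellin_comp_sub_half, hκG]
    have hpline : ∀ t : ℝ, weilMellin (fun y ↦ κ (y + x)) (1 / 2 + t * I) = cexp (-(t * x * I)) * G t :=
      fun t ↦ by
        have h := weilMellin_comp_sub_half κ (-x) t
        simp only [sub_neg_eq_add] at h
        rw [h, hκG]; congr 1; congr 1; push_cast; ring
    have hcos : ∀ t : ℝ, cexp (t * x * I) + cexp (-(t * x * I)) = 2 * Real.cos (x * t) := fun t ↦ by
      rw [show (t : ℂ) * x * I = ((x * t : ℝ) : ℂ) * I by push_cast; ring, ← Complex.cos_add_sin_I,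
        show -(((x * t : ℝ) : ℂ) * I) = (-((x * t : ℝ) : ℂ)) * I by ring, ← Complex.cos_add_sin_I,
        Complex.cos_neg, Complex.sin_neg, ← Complex.ofReal_cos]
      ring
    have hsin : ∀ t : ℝ, cexp (t * x * I) - cexp (-(t * x * I)) = 2 * I * Real.sin (x * t) := fun t ↦ by
      rw [show (t : ℂ) * x * I = ((x * t : ℝ) : ℂ) * I by push_cast; ring, ← Complex.cos_add_sin_I,
        show -(((x * t : ℝ) : ℂ) * I) = (-((x * t : ℝ) : ℂ)) * I by ring, ← Complex.cos_add_sin_I,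
        Complex.cos_neg, Complex.sin_neg, ← Complex.ofReal_sin]
      ring
    have hkcline : ∀ t : ℝ, weilMellin kc (1 / 2 + t * I) = ((G t * (1 + Real.cos (x * t)) : ℝ) : ℂ) := by
      intro t
      set d : ℝ → ℂ := (fun y ↦ κ (y - x)) + fun y ↦ κ (y + x) with hd
      have hdc : Continuous d := hm.add hp
      have hdcs : HasCompactSupport d := hmcs.add hpcs
      have h2c : Continuous fun y ↦ (1 / 2 : ℂ) * d y := continuous_const.mul hdc
      have h2cs : HasCompactSupport fun y ↦ (1 / 2 : ℂ) * d y := hdcs.mul_left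
      have e : kc = κ + fun y ↦ (1 / 2 : ℂ) * d y := by
        funext y; simp only [hkc, hd, Pi.add_apply]; ring
      have hdline : weilMellin d (1 / 2 + t * I) = 2 * Real.cos (x * t) * G t := by
        rw [hd, weilMellin_add hm hmcs hp hpcs, hmline, hpline, ← hcos]
        ring
      rw [e, weilMellin_add hκc hκcs h2c h2cs, weilMellin_const_mul, hdline, hκG]
      push_cast; ring
    have hksline : ∀ t : ℝ, weilMellin ks (1 / 2 + t * I) = ((G t * (1 + Real.sin (x * t)) : ℝ) : ℂ) := by
      intro t
      have hp' : Continuous fun y : ℝ ↦ (-1 : ℂ) * κ (y + x) := continuous_const.mul hp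
      have hpcs' : HasCompactSupport fun y : ℝ ↦ (-1 : ℂ) * κ (y + x) := hpcs.mul_left
      set d : ℝ → ℂ := (fun y ↦ κ (y - x)) + fun y ↦ (-1 : ℂ) * κ (y + x) with hd
      have hdc : Continuous d := hm.add hp'
      have hdcs : HasCompactSupport d := hmcs.add hpcs'
      have h2c : Continuous fun y ↦ (1 / (2 * I) : ℂ) * d y := continuous_const.mul hdc
      have h2cs : HasCompactSupport fun y ↦ (1 / (2 * I) : ℂ) * d y := hdcs.mul_left
      have e : ks = κ + fun y ↦ (1 / (2 * I) : ℂ) * d y := by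
        funext y; simp only [hks, hd, Pi.add_apply]; ring
      have hdline : weilMellin d (1 / 2 + t * I) = 2 * I * Real.sin (x * t) * G t := by
        rw [hd, weilMellin_add hm hmcs hp' hpcs', weilMellin_const_mul, hmline, hpline, ← hsin]
        ring
      rw [e, weilMellin_add hκc hκcs h2c h2cs, weilMellin_const_mul, hdline, hκG]
      have hI : (2 : ℂ) * I ≠ 0 := mul_ne_zero two_ne_zero Complex.I_ne_zero
      field_simp
      push_cast; ring
    -- signs and decay
    have hc0 : ∀ t, 0 ≤ G t * (1 + Real.cos (x * t)) := fun t ↦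
      mul_nonneg (hGpos t).le (by linarith [Real.neg_one_le_cos (x * t)])
    have hs0 : ∀ t, 0 ≤ G t * (1 + Real.sin (x * t)) := fun t ↦
      mul_nonneg (hGpos t).le (by linarith [Real.neg_one_le_sin (x * t)])
    have hdec : ∀ (φ : ℝ → ℝ), (∀ t, |φ t| ≤ 1) → ∀ t : ℝ,
        ‖(((G t * (1 + φ t)) : ℝ) : ℂ)‖ ≤ 72 / (1 + t ^ 2) := by
      intro φ hφ t
      rw [Complex.norm_real, Real.norm_eq_abs, abs_mul, abs_of_pos (hGpos t)]
      have h1 : |1 + φ t| ≤ 2 := by have := hφ t; rw [abs_le] at this ⊢; constructor <;> linarith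
      calc G t * |1 + φ t| ≤ 36 / (1 + t ^ 2) * 2 :=
            mul_le_mul (hGle t) h1 (abs_nonneg _) (by positivity)
        _ = 72 / (1 + t ^ 2) := by ring
    have hb : (2 : ℝ) + |x| < 2 * (|x| + 3) := by linarith [abs_nonneg x]
    obtain ⟨hIc, hWc⟩ := weilFunctional_kernel_eq_integral (b := |x| + 3) (by positivity)
      (hμb _) hkcc hb hkcs (M := 72)
      (fun u ↦ by rw [hkcline]; exact hdec _ (fun t ↦ Real.abs_cos_le_one _) u)
      (fun u ↦ by rw [hkcline]; exact ⟨Complex.ofReal_im _, by rw [Complex.ofReal_re]; exact hc0 u⟩)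
    obtain ⟨hIs, hWs⟩ := weilFunctional_kernel_eq_integral (b := |x| + 3) (by positivity)
      (hμb _) hksc hb hkss (M := 72)
      (fun u ↦ by rw [hksline]; exact hdec _ (fun t ↦ Real.abs_sin_le_one _) u)
      (fun u ↦ by rw [hksline]; exact ⟨Complex.ofReal_im _, by rw [Complex.ofReal_re]; exact hs0 u⟩)
    simp only [hkcline, Complex.ofReal_re] at hIc hWc
    simp only [hksline, Complex.ofReal_re] at hIs hWs
    refine ⟨?_, ?_, hWc.symm, hWs.symm⟩
    · exact (hIc.sub hIG).congr (ae_of_all _ fun t ↦ by simp only [Pi.sub_apply]; ring)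
    · exact (hIs.sub hIG).congr (ae_of_all _ fun t ↦ by simp only [Pi.sub_apply]; ring)
  -- the finite measures `G · μᵢ` have the same characteristic function
  obtain ⟨hIG₁, hx₁⟩ := key h₁
  obtain ⟨hIG₂, hx₂⟩ := key h₂
  have hGm : Measurable fun t ↦ ENNReal.ofReal (G t) := (hGc.measurable).ennreal_ofReal
  set ν₁ : Measure ℝ := μ₁.withDensity fun t ↦ ENNReal.ofReal (G t) with hν₁
  set ν₂ : Measure ℝ := μ₂.withDensity fun t ↦ ENNReal.ofReal (G t) with hν₂
  haveI : IsFiniteMeasure ν₁ := isFiniteMeasure_withDensity_ofReal hIG₁.2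
  haveI : IsFiniteMeasure ν₂ := isFiniteMeasure_withDensity_ofReal hIG₂.2
  have hchar : ∀ {μ : Measure ℝ}, Integrable G μ →
      (∀ x : ℝ, Integrable (fun t ↦ G t * Real.cos (x * t)) μ ∧
        Integrable (fun t ↦ G t * Real.sin (x * t)) μ ∧
        (((∫ t, G t * (1 + Real.cos (x * t)) ∂μ : ℝ) : ℂ) =
          weilFunctional (fun y ↦ κ y + (κ (y - x) + κ (y + x)) / 2)) ∧
        (((∫ t, G t * (1 + Real.sin (x * t)) ∂μ : ℝ) : ℂ) =
          weilFunctional (fun y ↦ κ y + (κ (y - x) - κ (y + x)) / (2 * I)))) →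
      ∀ x : ℝ, charFun (μ.withDensity fun t ↦ ENNReal.ofReal (G t)) x =
        weilFunctional (fun y ↦ κ y + (κ (y - x) + κ (y + x)) / 2) +
          I * weilFunctional (fun y ↦ κ y + (κ (y - x) - κ (y + x)) / (2 * I)) -
          (1 + I) * ((∫ t, G t ∂μ : ℝ) : ℂ) := by
    intro μ hIG hx x
    obtain ⟨hIcos, hIsin, hc, hs⟩ := hx x
    rw [charFun_apply_real, integral_withDensity_eq_integral_toReal_smul hGm
      (Eventually.of_forall fun _ ↦ ENNReal.ofReal_lt_top)]
    have hpt : ∀ t : ℝ, (ENNReal.ofReal (G t)).toReal • cexp (x * t * I) =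
        ((G t * Real.cos (x * t) : ℝ) : ℂ) + I * ((G t * Real.sin (x * t) : ℝ) : ℂ) := by
      intro t
      rw [ENNReal.toReal_ofReal (hGpos t).le, Complex.real_smul,
        show (x : ℂ) * t * I = ((x * t : ℝ) : ℂ) * I by push_cast; ring, ← Complex.cos_add_sin_I,
        ← Complex.ofReal_cos, ← Complex.ofReal_sin]
      push_cast; ring
    simp_rw [hpt]
    have hI1 : Integrable (fun t ↦ ((G t * Real.cos (x * t) : ℝ) : ℂ)) μ := hIcos.ofReal
    have hI2 : Integrable (fun t ↦ I * ((G t * Real.sin (x * t) : ℝ) : ℂ)) μ := hIsin.ofReal.const_mul I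
    rw [integral_add hI1 hI2, MeasureTheory.integral_const_mul, integral_complex_ofReal,
      integral_complex_ofReal, ← hc, ← hs]
    have e1 : ∫ t, G t * (1 + Real.cos (x * t)) ∂μ = (∫ t, G t ∂μ) + ∫ t, G t * Real.cos (x * t) ∂μ := by
      rw [← integral_add hIG hIcos]; exact integral_congr_ae (ae_of_all _ fun t ↦ by ring)
    have e2 : ∫ t, G t * (1 + Real.sin (x * t)) ∂μ = (∫ t, G t ∂μ) + ∫ t, G t * Real.sin (x * t) ∂μ := by
      rw [← integral_add hIG hIsin]; exact integral_congr_ae (ae_of_all _ fun t ↦ by ring)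
    rw [e1, e2]
    push_cast
    ring
  have hG₁₂ : ∫ t, G t ∂μ₁ = ∫ t, G t ∂μ₂ := by
    have h1 := (hx₁ 0).2.2.1
    have h2 := (hx₂ 0).2.2.1
    simp only [zero_mul, Real.cos_zero, mul_add, mul_one] at h1 h2
    have e : ∀ {μ : Measure ℝ}, Integrable G μ → ∫ t, (G t + G t) ∂μ = 2 * ∫ t, G t ∂μ := fun hI ↦ by
      rw [integral_add hI hI]; ring
    rw [e hIG₁] at h1
    rw [e hIG₂] at h2
    have := h1.trans h2.symm
    exact_mod_cast (mul_right_injective₀ (two_ne_zero' ℝ)) (by exact_mod_cast this)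
  have hνeq : ν₁ = ν₂ := by
    refine Measure.ext_of_charFun (funext fun x ↦ ?_)
    rw [hchar hIG₁ hx₁ x, hchar hIG₂ hx₂ x, hG₁₂]
  -- remove the density
  have hne0 : ∀ t, ENNReal.ofReal (G t) ≠ 0 := fun t ↦ (ENNReal.ofReal_pos.2 (hGpos t)).ne'
  calc μ₁ = ν₁.withDensity fun t ↦ (ENNReal.ofReal (G t))⁻¹ :=
        (withDensity_inv_same hGm (ae_of_all _ hne0) (ae_of_all _ fun _ ↦ ENNReal.ofReal_ne_top)).symm
    _ = ν₂.withDensity fun t ↦ (ENNReal.ofReal (G t))⁻¹ := by rw [hνeq]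
    _ = μ₂ := withDensity_inv_same hGm (ae_of_all _ hne0) (ae_of_all _ fun _ ↦ ENNReal.ofReal_ne_top)

/-! ## RH ⟺ a UNIQUE positive spectral measure; identification with the zeros -/

/-- From the linear representation on all tests to the representation of squares. -/
theorem represents_of_forall_integral_weilMellin {μ : Measure ℝ}
    (hμ : ∀ k : ℝ → ℂ, IsWeilTest k →
      Integrable (fun t : ℝ ↦ weilMellin k (1 / 2 + t * I)) μ ∧
        ∫ t, weilMellin k (1 / 2 + t * I) ∂μ = weilFunctional k) :
    ∀ g : ℝ → ℂ, IsWeilTest g →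
      Integrable (fun t : ℝ ↦ ‖weilMellin g (1 / 2 + t * I)‖ ^ 2) μ ∧
        weilQuadratic g = ((∫ t, ‖weilMellin g (1 / 2 + t * I)‖ ^ 2 ∂μ : ℝ) : ℂ) := by
  intro g hg
  obtain ⟨hI, hW⟩ := hμ _ (hg.weilConv hg.weilReflect)
  have hline : ∀ t : ℝ, weilMellin (weilConv g (weilReflect g)) (1 / 2 + t * I) =
      ((‖weilMellin g (1 / 2 + t * I)‖ ^ 2 : ℝ) : ℂ) := fun t ↦ weilMellin_weilConv_weilReflect_half hg t
  simp_rw [hline] at hI hW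
  refine ⟨?_, ?_⟩
  · exact hI.re.congr (ae_of_all _ fun t ↦ by
      simp only [RCLike.re_to_complex, Complex.ofReal_re])
  · rw [weilQuadratic, ← hW, integral_complex_ofReal]

/-- **RH ⟺ there is a UNIQUE positive measure on the critical line reproducing the explicit formula on
all tests.** (`riemannHypothesis_iff_exists_spectral_measure` + `eq_of_forall_represents`.) -/
theorem riemannHypothesis_iff_existsUnique_spectral_measure :
    _root_.RiemannHypothesis ↔ ∃! μ : Measure ℝ, ∀ k : ℝ → ℂ, IsWeilTest k →
      Integrable (fun t : ℝ ↦ weilMellin k (1 / 2 + t * I)) μ ∧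
        ∫ t, weilMellin k (1 / 2 + t * I) ∂μ = weilFunctional k := by
  rw [riemannHypothesis_iff_exists_spectral_measure]
  constructor
  · rintro ⟨μ, hμ⟩
    exact ⟨μ, hμ, fun μ' hμ' ↦ eq_of_forall_represents (represents_of_forall_integral_weilMellin hμ')
      (represents_of_forall_integral_weilMellin hμ)⟩
  · rintro ⟨μ, hμ, -⟩
    exact ⟨μ, hμ⟩

/-- **Under RH the spectral measure is the zero-counting measure.**  If the Riemann hypothesis holds,
every positive measure reproducing the explicit formula on all tests equals
`Σ_ρ m_ρ δ_{Im ρ}` (`WeilBochner.zetaZeroHeightMeasure`). -/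
theorem eq_zetaZeroHeightMeasure_of_riemannHypothesis (hRH : _root_.RiemannHypothesis) {μ : Measure ℝ}
    (hμ : ∀ k : ℝ → ℂ, IsWeilTest k →
      Integrable (fun t : ℝ ↦ weilMellin k (1 / 2 + t * I)) μ ∧
        ∫ t, weilMellin k (1 / 2 + t * I) ∂μ = weilFunctional k) :
    μ = WeilBochner.zetaZeroHeightMeasure :=
  eq_of_forall_represents (represents_of_forall_integral_weilMellin hμ)
    fun _ hg ↦ WeilBochner.weilQuadratic_eq_integral_of_riemannHypothesis hRH hg

end Summit.RiemannHypothesis.RiemannHypothesis.Theorems.WeilBochnerMeasure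

end
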